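import Literature.Analysis.SpecialFunctions.QRacahSumRecurrence

/-!
# Rogers' terminating very-well-poised `₆φ₅` sum in symmetric quantum numbers

With `[m] = (pᵐ - p⁻ᵐ)/(p - p⁻¹)` (`qBr` of `QRacahSumRecurrence.lean`) and the symmetric shifted factorial
`⟨u⟩_y = [u][u+1]⋯[u+y-1]` (`qPoch`), the terminating very-well-poised `₆φ₅` summation formula of Rogers/Jackson
(Gasper–Rahman (2.4.2) = (II.21), `₆φ₅(a, qa^½, -qa^½, b, c, q⁻ⁿ; a^½, -a^½, aq/b, aq/c, aq^{n+1}; q, aq^{n+1}/bc)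
= (aq, aq/bc; q)_n / (aq/b, aq/c; q)_n`) reads, for integers `α, β, γ` and `n ∈ ℕ` (the series is balanced, so all powers of
`p` and all signs cancel when `a = q^α, b = q^β, c = q^γ`, `q = p²`):

  `Σ_{y=0}^{n} [α+2y] ⟨α⟩_y ⟨β⟩_y ⟨γ⟩_y ⟨-n⟩_y / (⟨1⟩_y ⟨α+1-β⟩_y ⟨α+1-γ⟩_y ⟨α+1+n⟩_y)
      = [α] ⟨α+1⟩_n ⟨α+1-β-γ⟩_n / (⟨α+1-β⟩_n ⟨α+1-γ⟩_n)`                                  (`rogers_sum`)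

proved by the WZ method: with `ρ_n = [α+1-β+n][α+1-γ+n]/([α+1+n][α+1-β-γ+n])` (the ratio of consecutive right sides)
`ρ_n t_{n+1}(y) - t_n(y) = G_n(y+1) - G_n(y)` for an explicit hypergeometric certificate `G_n` (`rogers_wz`), which rests on
the four-term bracket identity `rogers_bracket_identity`; summing over `y` telescopes (`rogers_step`). The hypotheses are
only the non-vanishing of the brackets that occur as denominators along the induction (`[1+s], [α+1-β+s], [α+1-γ+s],
[α+1-β-γ+s]` for `s < n` and `[α+1+s]` for `s < 2n`), so the result specialises to roots of unity. Use: the norm of the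
extremal column in the orthogonality of the Kauffman–Lins `q`-6j symbols
(`RepresentationTheory/ModularTensorCategories/KLRacah*.lean`). No named facts.

## References

* G. Gasper, M. Rahman, *Basic Hypergeometric Series* (2004), §2.4 eq. (2.4.2), Appendix (II.21). [GasperRahman2004]
-/

namespace Literature.Analysis.SpecialFunctions

open Finset

variable {K : Type*} [Field K]

/-- The symmetric shifted factorial `⟨u⟩_y = [u][u+1]⋯[u+y-1]` (`u ∈ ℤ`).
[cite: GasperRahman2004, §1.2 (q-shifted factorials; symmetric normalisation)] -/
def qPoch (p : K) (u : ℤ) (y : ℕ) : K := ∏ s ∈ range y, qBr p (u + s)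

/-- `⟨u⟩_0 = 1`. [folklore] -/
@[simp] theorem qPoch_zero (p : K) (u : ℤ) : qPoch p u 0 = 1 := by simp [qPoch]

/-- `⟨u⟩_{y+1} = ⟨u⟩_y [u+y]`. [folklore] -/
theorem qPoch_succ (p : K) (u : ℤ) (y : ℕ) : qPoch p u (y + 1) = qPoch p u y * qBr p (u + y) := by
  simp [qPoch, prod_range_succ]

/-- `⟨u⟩_{y+1} = [u] ⟨u+1⟩_y`. [folklore] -/
theorem qPoch_succ_left (p : K) (u : ℤ) (y : ℕ) : qPoch p u (y + 1) = qBr p u * qPoch p (u + 1) y := by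
  unfold qPoch
  rw [prod_range_succ', mul_comm]
  simp only [Nat.cast_zero, add_zero, Nat.cast_add, Nat.cast_one]
  congr 1
  exact prod_congr rfl fun s _ => by ring_nf

/-- `⟨u⟩_y ≠ 0` when its factors are non-zero. [folklore] -/
theorem qPoch_ne_zero (p : K) {u : ℤ} {y : ℕ} (h : ∀ s : ℕ, s < y → qBr p (u + s) ≠ 0) : qPoch p u y ≠ 0 := by
  unfold qPoch
  exact prod_ne_zero_iff.mpr fun s hs => h s (mem_range.mp hs)

/-- `⟨-n⟩_y = 0` for `y ≥ n + 1` (the factor `[0]`): the series terminates. [folklore] -/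
theorem qPoch_neg_eq_zero (p : K) (n : ℕ) {y : ℕ} (h : n + 1 ≤ y) : qPoch p (-(n : ℤ)) y = 0 := by
  unfold qPoch
  exact prod_eq_zero (i := n) (mem_range.mpr (by omega)) (by simp)

/-- `[-m] = -[m]`. [folklore] -/
theorem qBr_neg (p : K) (m : ℤ) : qBr p (-m) = -qBr p m := by
  unfold qBr; rw [neg_neg, ← neg_div, neg_sub]

/-- The summand `t_n(y) = [α+2y]⟨α⟩_y⟨β⟩_y⟨γ⟩_y⟨-n⟩_y/(⟨1⟩_y⟨α+1-β⟩_y⟨α+1-γ⟩_y⟨α+1+n⟩_y)` of the very-well-poised `₆φ₅`.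
[cite: GasperRahman2004, §2.4 eq. (2.4.2)] -/
def rogersTerm (p : K) (α β γ : ℤ) (n y : ℕ) : K :=
  qBr p (α + 2 * y) * qPoch p α y * qPoch p β y * qPoch p γ y * qPoch p (-(n : ℤ)) y /
    (qPoch p 1 y * qPoch p (α + 1 - β) y * qPoch p (α + 1 - γ) y * qPoch p (α + 1 + n) y)

/-- The right side `[α]⟨α+1⟩_n⟨α+1-β-γ⟩_n/(⟨α+1-β⟩_n⟨α+1-γ⟩_n)`. [cite: GasperRahman2004, §2.4 eq. (2.4.2)] -/
def rogersRHS (p : K) (α β γ : ℤ) (n : ℕ) : K :=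
  qBr p α * qPoch p (α + 1) n * qPoch p (α + 1 - β - γ) n / (qPoch p (α + 1 - β) n * qPoch p (α + 1 - γ) n)

/-- The four-term bracket identity behind the WZ pair:
`[α+1-β+n][α+1-γ+n][-n-1][α+2y] - [α+2y][y-n-1][α+1+n+y][α+1-β-γ+n] = [α+y][β+y][γ+y][y-n-1] - [y][α-β+y][α-γ+y][α+1+n+y]`.
[folklore] -/
theorem rogers_bracket_identity (p : K) (hp : p ≠ 0) (α β γ n y : ℤ) :
    qBr p (α + 1 - β + n) * qBr p (α + 1 - γ + n) * qBr p (-n - 1) * qBr p (α + 2 * y) -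
        qBr p (α + 2 * y) * qBr p (y - n - 1) * qBr p (α + 1 + n + y) * qBr p (α + 1 - β - γ + n) =
      qBr p (α + y) * qBr p (β + y) * qBr p (γ + y) * qBr p (y - n - 1) -
        qBr p y * qBr p (α - β + y) * qBr p (α - γ + y) * qBr p (α + 1 + n + y) := by
  have hA : p ^ α ≠ 0 := zpow_ne_zero _ hp
  have hB : p ^ β ≠ 0 := zpow_ne_zero _ hp
  have hC : p ^ γ ≠ 0 := zpow_ne_zero _ hp
  have hN : p ^ n ≠ 0 := zpow_ne_zero _ hp
  have hY : p ^ y ≠ 0 := zpow_ne_zero _ hp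
  rw [show α + 2 * y = α + y + y by ring]
  simp only [qBr, zpow_add₀ hp, zpow_sub₀ hp, zpow_neg, zpow_ofNat]
  field_simp
  ring

section Rogers

variable (p : K) (α β γ : ℤ)

/-- The WZ core `C_n(y) = ⟨α⟩_y⟨β⟩_y⟨γ⟩_y⟨-n-1⟩_y/(⟨1⟩_y⟨α+1-β⟩_y⟨α+1-γ⟩_y⟨α+2+n⟩_y)` (`= t_{n+1}(y)/[α+2y]`). [folklore] -/
def rogersCore (n y : ℕ) : K :=
  qPoch p α y * qPoch p β y * qPoch p γ y * qPoch p (-(n : ℤ) - 1) y /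
    (qPoch p 1 y * qPoch p (α + 1 - β) y * qPoch p (α + 1 - γ) y * qPoch p (α + 2 + n) y)

/-- The WZ certificate `G_n(y) = C_n(y)[y][α-β+y][α-γ+y][α+1+n+y]/([-n-1][α+1+n][α+1-β-γ+n])` (`G_n(0) = 0`). [folklore] -/
def rogersG (n y : ℕ) : K :=
  rogersCore p α β γ n y * (qBr p y * qBr p (α - β + y) * qBr p (α - γ + y) * qBr p (α + 1 + n + y)) /
    (qBr p (-(n : ℤ) - 1) * qBr p (α + 1 + n) * qBr p (α + 1 - β - γ + n))

variable {p α β γ}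

/-- `t_{n+1}(y) = C_n(y)[α+2y]`. [folklore] -/
theorem rogersTerm_succ_eq (n y : ℕ) : rogersTerm p α β γ (n + 1) y = rogersCore p α β γ n y * qBr p (α + 2 * y) := by
  unfold rogersTerm rogersCore
  rw [show -((n + 1 : ℕ) : ℤ) = -(n : ℤ) - 1 by push_cast; ring,
    show α + 1 + ((n + 1 : ℕ) : ℤ) = α + 2 + n by push_cast; ring]
  ring

/-- The non-vanishing bookkeeping of one induction step at level `n → n+1` (the brackets that occur as
denominators). [folklore] -/
structure RogersHyp (p : K) (α β γ : ℤ) (n : ℕ) : Prop where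
  /-- `[1+s] ≠ 0` for `s ≤ n` -/
  h1 : ∀ s : ℕ, s ≤ n → qBr p (1 + s) ≠ 0
  /-- `[α+1-β+s] ≠ 0` for `s ≤ n` -/
  h2 : ∀ s : ℕ, s ≤ n → qBr p (α + 1 - β + s) ≠ 0
  /-- `[α+1-γ+s] ≠ 0` for `s ≤ n` -/
  h3 : ∀ s : ℕ, s ≤ n → qBr p (α + 1 - γ + s) ≠ 0
  /-- `[α+1+s] ≠ 0` for `s ≤ 2n+1` -/
  h4 : ∀ s : ℕ, s ≤ 2 * n + 1 → qBr p (α + 1 + s) ≠ 0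
  /-- `[α+1-β-γ+s] ≠ 0` for `s ≤ n` -/
  h5 : ∀ s : ℕ, s ≤ n → qBr p (α + 1 - β - γ + s) ≠ 0

/-- The denominators of the core are non-zero for `y ≤ n + 1`. [folklore] -/
theorem rogersCore_den_ne_zero {n : ℕ} (H : RogersHyp p α β γ n) {y : ℕ} (hy : y ≤ n + 1) :
    qPoch p 1 y * qPoch p (α + 1 - β) y * qPoch p (α + 1 - γ) y * qPoch p (α + 2 + n) y ≠ 0 := by
  refine mul_ne_zero (mul_ne_zero (mul_ne_zero ?_ ?_) ?_) ?_
  · exact qPoch_ne_zero p fun s hs => H.h1 s (by omega)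
  · exact qPoch_ne_zero p fun s hs => H.h2 s (by omega)
  · exact qPoch_ne_zero p fun s hs => H.h3 s (by omega)
  · exact qPoch_ne_zero p fun s hs => by
      rw [show α + 2 + n + s = α + 1 + ((n + 1 + s : ℕ) : ℤ) by push_cast; ring]
      exact H.h4 _ (by omega)

/-- `t_n(y) = C_n(y)[α+2y][y-n-1][α+1+n+y]/([-n-1][α+1+n])` for `y ≤ n + 1`. [folklore] -/
theorem rogersTerm_eq {n : ℕ} (H : RogersHyp p α β γ n) {y : ℕ} (hy : y ≤ n + 1) :
    rogersTerm p α β γ n y =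
      rogersCore p α β γ n y * (qBr p (α + 2 * y) * qBr p ((y : ℤ) - n - 1) * qBr p (α + 1 + n + y)) /
        (qBr p (-(n : ℤ) - 1) * qBr p (α + 1 + n)) := by
  have hn1 : qBr p (-(n : ℤ) - 1) ≠ 0 := by
    rw [show -(n : ℤ) - 1 = -(1 + (n : ℤ)) by ring, qBr_neg, neg_ne_zero]; exact H.h1 n le_rfl
  have ha : qBr p (α + 1 + n) ≠ 0 := by exact_mod_cast H.h4 n (by omega)
  have hay : qBr p (α + 1 + n + y) ≠ 0 := by
    rw [show α + 1 + n + y = α + 1 + ((n + y : ℕ) : ℤ) by push_cast; ring]; exact H.h4 _ (by omega)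
  -- `⟨-n⟩_y [-n-1] = ⟨-n-1⟩_y [-n-1+y]` and `⟨α+1+n⟩_y [α+1+n+y] = [α+1+n] ⟨α+2+n⟩_y`
  have e1 : qPoch p (-(n : ℤ)) y = qPoch p (-(n : ℤ) - 1) y * qBr p ((y : ℤ) - n - 1) / qBr p (-(n : ℤ) - 1) := by
    have h := qPoch_succ p (-(n : ℤ) - 1) y
    rw [qPoch_succ_left, show -(n : ℤ) - 1 + 1 = -(n : ℤ) by ring] at h
    rw [eq_div_iff hn1, show (y : ℤ) - n - 1 = -(n : ℤ) - 1 + y by ring, ← h, mul_comm]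
  have e2 : qPoch p (α + 1 + n) y = qBr p (α + 1 + n) * qPoch p (α + 2 + n) y / qBr p (α + 1 + n + y) := by
    have h := qPoch_succ p (α + 1 + n) y
    rw [qPoch_succ_left, show α + 1 + n + 1 = α + 2 + n by ring] at h
    rw [eq_div_iff hay, h]
  have hq1 : qPoch p 1 y ≠ 0 := qPoch_ne_zero p fun s hs => H.h1 s (by omega)
  have hq2 : qPoch p (α + 1 - β) y ≠ 0 := qPoch_ne_zero p fun s hs => H.h2 s (by omega)
  have hq3 : qPoch p (α + 1 - γ) y ≠ 0 := qPoch_ne_zero p fun s hs => H.h3 s (by omega)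
  have hq4 : qPoch p (α + 2 + n) y ≠ 0 := qPoch_ne_zero p fun s hs => by
    rw [show α + 2 + n + s = α + 1 + ((n + 1 + s : ℕ) : ℤ) by push_cast; ring]; exact H.h4 _ (by omega)
  unfold rogersTerm rogersCore
  rw [e1, e2]
  field_simp

/-- `G_n(y+1) = C_n(y)[α+y][β+y][γ+y][y-n-1]/([-n-1][α+1+n][α+1-β-γ+n])` for `y ≤ n + 1` (for `y = n + 1` both sides
vanish). [folklore] -/
theorem rogersG_succ {n : ℕ} (H : RogersHyp p α β γ n) {y : ℕ} (hy : y ≤ n + 1) :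
    rogersG p α β γ n (y + 1) =
      rogersCore p α β γ n y * (qBr p (α + y) * qBr p (β + y) * qBr p (γ + y) * qBr p ((y : ℤ) - n - 1)) /
        (qBr p (-(n : ℤ) - 1) * qBr p (α + 1 + n) * qBr p (α + 1 - β - γ + n)) := by
  rcases Nat.lt_or_ge y (n + 1) with hy' | hy'
  · -- `y ≤ n`: the ratio `C_n(y+1)/C_n(y)`
    have hq1 : qPoch p 1 y ≠ 0 := qPoch_ne_zero p fun s hs => H.h1 s (by omega)
    have hq2 : qPoch p (α + 1 - β) y ≠ 0 := qPoch_ne_zero p fun s hs => H.h2 s (by omega)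
    have hq3 : qPoch p (α + 1 - γ) y ≠ 0 := qPoch_ne_zero p fun s hs => H.h3 s (by omega)
    have hq4 : qPoch p (α + 2 + n) y ≠ 0 := qPoch_ne_zero p fun s hs => by
      rw [show α + 2 + n + s = α + 1 + ((n + 1 + s : ℕ) : ℤ) by push_cast; ring]; exact H.h4 _ (by omega)
    have h1 : qBr p (1 + y) ≠ 0 := H.h1 y (by omega)
    have h2 : qBr p (α + 1 - β + y) ≠ 0 := H.h2 y (by omega)
    have h3 : qBr p (α + 1 - γ + y) ≠ 0 := H.h3 y (by omega)
    have h4 : qBr p (α + 2 + n + y) ≠ 0 := by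
      rw [show α + 2 + n + y = α + 1 + ((n + 1 + y : ℕ) : ℤ) by push_cast; ring]; exact H.h4 _ (by omega)
    have eC : rogersCore p α β γ n (y + 1) = rogersCore p α β γ n y * (qBr p (α + y) * qBr p (β + y) * qBr p (γ + y) *
        qBr p (-(n : ℤ) - 1 + y)) / (qBr p (1 + y) * qBr p (α + 1 - β + y) * qBr p (α + 1 - γ + y) *
        qBr p (α + 2 + n + y)) := by
      unfold rogersCore
      simp only [qPoch_succ]
      field_simp
    unfold rogersG
    rw [eC, show ((y + 1 : ℕ) : ℤ) = 1 + (y : ℤ) by push_cast; ring, show -(n : ℤ) - 1 + y = (y : ℤ) - n - 1 by ring,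
      show α - β + (1 + (y : ℤ)) = α + 1 - β + y by ring, show α - γ + (1 + (y : ℤ)) = α + 1 - γ + y by ring,
      show α + 1 + n + (1 + (y : ℤ)) = α + 2 + n + y by ring]
    field_simp
  · -- `y = n + 1`: both sides vanish
    have hyn : y = n + 1 := by omega
    subst hyn
    have hz : rogersCore p α β γ n (n + 1 + 1) = 0 := by
      unfold rogersCore
      rw [show -(n : ℤ) - 1 = -((n + 1 : ℕ) : ℤ) by push_cast; ring, qPoch_neg_eq_zero p (n + 1) le_rfl]
      simp
    unfold rogersG
    rw [hz, show ((n + 1 : ℕ) : ℤ) - n - 1 = 0 by push_cast; ring, qBr_zero]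
    simp

/-- **The WZ equation**: `ρ_n t_{n+1}(y) - t_n(y) = G_n(y+1) - G_n(y)` for `y ≤ n + 1`, with
`ρ_n = [α+1-β+n][α+1-γ+n]/([α+1+n][α+1-β-γ+n])`. [cite: GasperRahman2004, §2.4 eq. (2.4.2)] -/
theorem rogers_wz (hp : p ≠ 0) {n : ℕ} (H : RogersHyp p α β γ n) {y : ℕ} (hy : y ≤ n + 1) :
    qBr p (α + 1 - β + n) * qBr p (α + 1 - γ + n) / (qBr p (α + 1 + n) * qBr p (α + 1 - β - γ + n)) *
          rogersTerm p α β γ (n + 1) y - rogersTerm p α β γ n y =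
      rogersG p α β γ n (y + 1) - rogersG p α β γ n y := by
  have hn1 : qBr p (-(n : ℤ) - 1) ≠ 0 := by
    rw [show -(n : ℤ) - 1 = -(1 + (n : ℤ)) by ring, qBr_neg, neg_ne_zero]; exact H.h1 n le_rfl
  have ha : qBr p (α + 1 + n) ≠ 0 := by exact_mod_cast H.h4 n (by omega)
  have h5 : qBr p (α + 1 - β - γ + n) ≠ 0 := H.h5 n le_rfl
  rw [rogersTerm_succ_eq, rogersTerm_eq H hy, rogersG_succ H hy]
  unfold rogersG
  have key := rogers_bracket_identity p hp α β γ n y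
  field_simp
  linear_combination rogersCore p α β γ n y * key

/-- The sum `S_n = Σ_{y=0}^{n} t_n(y)`. [cite: GasperRahman2004, §2.4 eq. (2.4.2)] -/
def rogersSum (p : K) (α β γ : ℤ) (n : ℕ) : K := ∑ y ∈ range (n + 1), rogersTerm p α β γ n y

/-- One induction step: `ρ_n S_{n+1} = S_n` (sum the WZ equation over `0 ≤ y ≤ n+1`; `t_n(n+1) = 0`, `G_n(0) = G_n(n+2) = 0`).
[cite: GasperRahman2004, §2.4 eq. (2.4.2)] -/
theorem rogers_step (hp : p ≠ 0) {n : ℕ} (H : RogersHyp p α β γ n) :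
    qBr p (α + 1 - β + n) * qBr p (α + 1 - γ + n) / (qBr p (α + 1 + n) * qBr p (α + 1 - β - γ + n)) *
        rogersSum p α β γ (n + 1) = rogersSum p α β γ n := by
  unfold rogersSum
  have htel : ∑ y ∈ range (n + 1 + 1), (rogersG p α β γ n (y + 1) - rogersG p α β γ n y) =
      rogersG p α β γ n (n + 1 + 1) - rogersG p α β γ n 0 := sum_range_sub _ _
  have hG0 : rogersG p α β γ n 0 = 0 := by unfold rogersG; simp
  have hG2 : rogersG p α β γ n (n + 1 + 1) = 0 := by
    unfold rogersG rogersCore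
    rw [show -(n : ℤ) - 1 = -((n + 1 : ℕ) : ℤ) by push_cast; ring, qPoch_neg_eq_zero p (n + 1) (by omega)]
    simp
  have hlast : rogersTerm p α β γ n (n + 1) = 0 := by
    unfold rogersTerm; rw [qPoch_neg_eq_zero p n le_rfl]; simp
  rw [hG0, hG2, sub_zero, ← sum_congr rfl fun y hy => rogers_wz hp H (Nat.lt_succ_iff.mp (mem_range.mp hy)),
    sum_sub_distrib, ← mul_sum, sum_range_succ (fun y => rogersTerm p α β γ n y) (n + 1), hlast, add_zero] at htel
  linear_combination htel

/-- `R_{n+1} ρ_n = R_n`... in the form `R_{n+1} = R_n [α+1+n][α+1-β-γ+n]/([α+1-β+n][α+1-γ+n])`. [folklore] -/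
theorem rogersRHS_succ (n : ℕ) (h2 : qBr p (α + 1 - β + n) ≠ 0) (h3 : qBr p (α + 1 - γ + n) ≠ 0) :
    rogersRHS p α β γ (n + 1) =
      rogersRHS p α β γ n * (qBr p (α + 1 + n) * qBr p (α + 1 - β - γ + n)) /
        (qBr p (α + 1 - β + n) * qBr p (α + 1 - γ + n)) := by
  unfold rogersRHS
  simp only [qPoch_succ]
  field_simp

/-- Monotonicity of the bookkeeping: the hypotheses at level `n + 1` imply those at level `n`. [folklore] -/
theorem RogersHyp.mono {n : ℕ} (H : RogersHyp p α β γ (n + 1)) : RogersHyp p α β γ n where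
  h1 s hs := H.h1 s (by omega)
  h2 s hs := H.h2 s (by omega)
  h3 s hs := H.h3 s (by omega)
  h4 s hs := H.h4 s (by omega)
  h5 s hs := H.h5 s (by omega)

/-- **Rogers' terminating very-well-poised `₆φ₅` sum** in symmetric quantum numbers:
`Σ_{y=0}^{n} [α+2y]⟨α⟩_y⟨β⟩_y⟨γ⟩_y⟨-n⟩_y/(⟨1⟩_y⟨α+1-β⟩_y⟨α+1-γ⟩_y⟨α+1+n⟩_y) = [α]⟨α+1⟩_n⟨α+1-β-γ⟩_n/(⟨α+1-β⟩_n⟨α+1-γ⟩_n)`,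
under the non-vanishing of the brackets met along the induction (`RogersHyp` at level `n - 1`; vacuous for `n = 0`).
[cite: GasperRahman2004, §2.4 eq. (2.4.2), Appendix (II.21)] -/
theorem rogers_sum (hp : p ≠ 0) : ∀ n : ℕ, (∀ m : ℕ, m < n → RogersHyp p α β γ m) →
    rogersSum p α β γ n = rogersRHS p α β γ n := by
  intro n
  induction n with
  | zero =>
    intro _
    unfold rogersSum rogersRHS rogersTerm
    simp
  | succ n ih =>
    intro hH
    have H : RogersHyp p α β γ n := hH n (Nat.lt_succ_self n)
    have ihn := ih fun m hm => hH m (by omega)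
    have step := rogers_step hp H
    have h2 : qBr p (α + 1 - β + n) ≠ 0 := H.h2 n le_rfl
    have h3 : qBr p (α + 1 - γ + n) ≠ 0 := H.h3 n le_rfl
    have ha : qBr p (α + 1 + n) ≠ 0 := by exact_mod_cast H.h4 n (by omega)
    have h5 : qBr p (α + 1 - β - γ + n) ≠ 0 := H.h5 n le_rfl
    rw [rogersRHS_succ n h2 h3, ← ihn, ← step]
    field_simp

end Rogers

end Literature.Analysis.SpecialFunctions
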